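import Literature.AlgebraicGeometry.Motives.MonomialLinearSystemIncidence
import Literature.AlgebraicGeometry.Motives.MonomialSupportedHypersurfaceFamily
import Literature.AlgebraicGeometry.Motives.UniversalHypersurfaceFibre
import HarnessLib

/-!
# The smooth `M`-supported family sits inside the incidence variety: `𝒴_M ↪ W_M` is an open immersion

Family `hodge`, layer `Literature/AlgebraicGeometry/Motives`; definitions with bodies and theorems
(no named fact). Notation of `Motives/MonomialSupportedHypersurfaceFamily` (`R = CoeffRing k n d`,
`R_M = CoeffRingM k n d M`, `killHom : R → R_M`, `S_M = baseM ⊆ 𝔸^M = Spec R_M` the nonsingular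
`M`-supported forms, `π_M : 𝒴_M = totalM → S_M` the base change of the universal smooth hypersurface
`𝒴 → U` along `S_M → U`) and of `Motives/MonomialLinearSystemIncidence` (`F_M`, the incidence variety
`W_M = V₊(F_M) ⊆ ℙⁿ⁺¹_{R_M}` with `incidenceιM`, `incidenceOverM : SchemeOver k`).

* `map_killHom_universalForm` — `killHom` carries the universal form `F` to `F_M`;
* `projMapM`, `isPullback_projMapM` — `ℙⁿ⁺¹_{R_M} = ℙⁿ⁺¹_R ×_{S^d} 𝔸^M` (`ProjBaseChangeRing.isPullback_projMap'`);
* `isPullback_totalM_totalToSpec` — `𝒴_M = 𝒴 ×_{S^d} S_M` as schemes (pasting Mathlib's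
  `isPullback_morphismRestrict` onto the defining pullback);
* `incidenceOpenM` — the open part `Z = ℙⁿ⁺¹_{R_M}|_{S_M}` of `ℙⁿ⁺¹_{R_M}` over `S_M`, with
  `isPullback_incidenceOpenM` (`Z = ℙⁿ⁺¹_R ×_{S^d} S_M`);
* `totalMEmb : 𝒴_M ⟶ Z`, `isPullback_totalMEmb`, `isClosedImmersion_totalMEmb`, `range_totalMEmb` —
  `𝒴_M ↪ Z` is the base change of `𝒴 ↪ ℙⁿ⁺¹_R`, a closed immersion with image `V₊(F_M) ∩ Z`;
* `incidenceRestrictM : W_M|_Z ⟶ Z` — the restriction of `W_M ↪ ℙⁿ⁺¹_{R_M}` over `Z`, a closed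
  immersion from a reduced scheme with the same image;
* `totalMIsoIncidenceRestrict` — **`𝒴_M ≅ W_M|_{S_M}`** (uniqueness of the reduced closed subscheme
  structure, `exists_iso_of_isClosedImmersion_of_range_eq`; Hartshorne II Example 3.2.6);
* `totalMToIncidence : totalM k n d M ⟶ incidenceOverM k n d M`, `isOpenImmersion_totalMToIncidence_left`
  — **the open immersion `𝒴_M ↪ W_M` of `k`-schemes**, and `totalMToIncidence_left_comp_incidenceιM`
  (its composite with `W_M ↪ ℙⁿ⁺¹_{R_M}` is `𝒴_M ↪ Z ⊆ ℙⁿ⁺¹_{R_M}`).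

This is the statement "`𝒴_M` is the open subset of the incidence variety `{(f, x) | f(x) = 0}` lying
over the nonsingular forms" (Voisin II §6.2.1 / §2.1.1) for the monomial linear system `M`; it is input
W1 of the no-invariants argument for the monodromy of `π_M`
(`HodgeTheory/MonomialSupportedHypersurfaceInvariantCycles`).

## References

* C. Voisin, *Hodge Theory and Complex Algebraic Geometry II* (2003), §2.1.1, §6.2.1. [VoisinHodgeII2003]
* R. Hartshorne, *Algebraic Geometry* (1977), II §3 (base extension), II Example 3.2.6, II Ex. 3.11(a).
  [Hartshorne1977]
* Q. Liu, *Algebraic Geometry and Arithmetic Curves* (2002), Prop. 3.1.9, Ex. 3.1.10. [Liu2002]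
-/

noncomputable section

open CategoryTheory CategoryTheory.Limits AlgebraicGeometry MvPolynomial

universe u

namespace Literature.AlgebraicGeometry.Motives.UniversalHypersurface

open scoped Classical in
/-- **`killHom` carries the universal form to the `M`-supported universal form**: `F ↦ F_M`
(the coefficients `a_m`, `m ∉ M`, are killed). [cite: VoisinHodgeII2003, §6.2.1] -/
theorem map_killHom_universalForm (k : Type u) [Field k] (n d : ℕ) (M : Set (DegIndex n d)) :
    MvPolynomial.map (killHom k n d M).toRingHom (universalForm k n d) = universalFormM k n d M := by
  let f' : DegIndex n d → MvPolynomial (Fin (n + 2)) (CoeffRingM k n d M) :=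
    fun x => if h : x ∈ M then monomial x.1 (X (⟨x, h⟩ : M)) else 0
  have hL : ∀ x : DegIndex n d,
      monomial x.1 ((killHom k n d M).toRingHom (X x)) = f' x := fun x => by
    by_cases h : x ∈ M
    · simp only [f', dif_pos h, AlgHom.toRingHom_eq_coe, RingHom.coe_coe, killHom_X_of_mem k n d M h]
    · simp only [f', dif_neg h, AlgHom.toRingHom_eq_coe, RingHom.coe_coe,
        killHom_X_of_not_mem k n d M h, map_zero]
  have hR : ∀ m : M, monomial m.1.1 (X m) = f' m := fun m => by
    simp only [f', dif_pos m.2]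
  rw [universalForm, map_sum, universalFormM]
  simp only [map_monomial]
  calc ∑ x : DegIndex n d, monomial x.1 ((killHom k n d M).toRingHom (X x))
      = ∑ x : DegIndex n d, f' x := Finset.sum_congr rfl fun x _ => hL x
    _ = ∑ x ∈ Finset.univ.filter (· ∈ M), f' x := by
        refine (Finset.sum_filter_of_ne fun x _ hx => ?_).symm
        by_contra h
        simp only [f', dif_neg h, ne_eq, not_true_eq_false] at hx
    _ = ∑ m : M, f' m := Finset.sum_subtype _ (fun x => by simp) f'
    _ = ∑ m : M, monomial m.1.1 (X m) := Finset.sum_congr rfl fun m _ => (hR m).symm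

section Squares

variable (k : Type u) [Field k] (n d : ℕ) (M : Set (DegIndex n d))

attribute [local instance] MvPolynomial.gradedAlgebra ProjBaseChange.algebraBase
  ProjBaseChange.isScalarTower_localization

/-- graded pieces of `R[x₀, …, x_{n+1}]` -/
local notation "𝒜" R => MvPolynomial.homogeneousSubmodule (Fin (n + 2)) R

/-! ### `ℙⁿ⁺¹_{R_M} = ℙⁿ⁺¹_R ×_{S^d} 𝔸^M` -/

/-- The base change `ℙⁿ⁺¹_{R_M} → ℙⁿ⁺¹_R` along `killHom : R → R_M` (Mathlib `Proj.map` of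
`R[x] → R_M[x]`). [cite: Liu2002, Prop. 3.1.9 and Ex. 3.1.10] -/
def projMapM : projSp n (CoeffRingM k n d M) ⟶ projSp n (CoeffRing k n d) :=
  letI : Algebra (CoeffRing k n d) (CoeffRingM k n d M) := (killHom k n d M).toRingHom.toAlgebra
  Proj.map (ProjBaseChangeRing.mapGraded (CoeffRing k n d) (CoeffRingM k n d M) (Fin (n + 2)))
    (ProjBaseChangeRing.irrelevant_le_map (CoeffRing k n d) (CoeffRingM k n d M) (Fin (n + 2)))

/-- **`ℙⁿ⁺¹_{R_M} = ℙⁿ⁺¹_R ×_{S^d} 𝔸^M`** along `𝔸^M ↪ S^d` (`ProjBaseChangeRing.isPullback_projMap'`).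
[cite: Liu2002, Prop. 3.1.9 and Ex. 3.1.10] -/
theorem isPullback_projMapM :
    IsPullback (projMapM k n d M) (projSpToSpec n (CoeffRingM k n d M))
      (projSpToSpec n (CoeffRing k n d)) (specKill k n d M) := by
  letI : Algebra (CoeffRing k n d) (CoeffRingM k n d M) := (killHom k n d M).toRingHom.toAlgebra
  exact ProjBaseChangeRing.isPullback_projMap' (CoeffRing k n d) (CoeffRingM k n d M)

/-- On points `projMapM` is contraction along `R[x] → R_M[x]`: `G ∈ 𝔭_{image}` iff `killHom G ∈ 𝔭`
(definition of `Proj.map`). [cite: Liu2002, Prop. 3.1.9 and Ex. 3.1.10] -/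
theorem mem_projMapM_apply_iff (q : projSp n (CoeffRingM k n d M))
    (G : MvPolynomial (Fin (n + 2)) (CoeffRing k n d)) :
    G ∈ (projMapM k n d M q).asHomogeneousIdeal ↔
      MvPolynomial.map (killHom k n d M).toRingHom G ∈ q.asHomogeneousIdeal :=
  Iff.rfl

/-! ### `𝒴_M = 𝒴 ×_{S^d} S_M` and the open part `Z = ℙⁿ⁺¹_{R_M}|_{S_M}` -/

/-- **`𝒴_M = 𝒴 ×_{S^d} S_M` as schemes**: the defining square `𝒴_M = 𝒴_U ×_U S_M` pasted with
`𝒴_U = 𝒴 ×_{S^d} U` (Mathlib `isPullback_morphismRestrict`). [cite: Hartshorne1977, II §3 (base extension)] -/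
theorem isPullback_totalM_totalToSpec :
    IsPullback
      (pullback.fst (family k n d).left (toBase k n d M).left ≫
        ((totalToSpec k n d) ⁻¹ᵁ (baseOpens k n d)).ι)
      (pullback.snd (family k n d).left (toBase k n d M).left) (totalToSpec k n d)
      ((baseMOpens k n d M).ι ≫ specKill k n d M) := by
  have h := (IsPullback.of_hasPullback (family k n d).left (toBase k n d M).left).paste_horiz
    (isPullback_morphismRestrict (totalToSpec k n d) (baseOpens k n d)).flip
  rw [toBase_left_comp_ι] at h
  exact h

/-- **The open part `Z = ℙⁿ⁺¹_{R_M}|_{S_M}`** of `ℙⁿ⁺¹_{R_M}` lying over the nonsingular forms.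
[cite: Hartshorne1977, II §3 (base extension)] -/
abbrev incidenceOpenM : (projSp n (CoeffRingM k n d M)).Opens :=
  projSpToSpec n (CoeffRingM k n d M) ⁻¹ᵁ baseMOpens k n d M

/-- **`Z = ℙⁿ⁺¹_R ×_{S^d} S_M`**: `Z = ℙⁿ⁺¹_{R_M} ×_{𝔸^M} S_M` (Mathlib `isPullback_morphismRestrict`)
pasted with `ℙⁿ⁺¹_{R_M} = ℙⁿ⁺¹_R ×_{S^d} 𝔸^M`. [cite: Hartshorne1977, II §3 (base extension)] -/
theorem isPullback_incidenceOpenM :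
    IsPullback ((incidenceOpenM k n d M).ι ≫ projMapM k n d M)
      (projSpToSpec n (CoeffRingM k n d M) ∣_ baseMOpens k n d M)
      (projSpToSpec n (CoeffRing k n d)) ((baseMOpens k n d M).ι ≫ specKill k n d M) :=
  (isPullback_morphismRestrict (projSpToSpec n (CoeffRingM k n d M)) (baseMOpens k n d M)).flip.paste_horiz
    (isPullback_projMapM k n d M)

/-! ### The closed immersion `𝒴_M ↪ Z` -/

/-- **The embedding `𝒴_M ⟶ Z = ℙⁿ⁺¹_{R_M}|_{S_M}`** with components `𝒴_M → 𝒴 ↪ ℙⁿ⁺¹_R` and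
`𝒴_M → S_M` (the universal property of `Z = ℙⁿ⁺¹_R ×_{S^d} S_M`). [cite: Hartshorne1977, II §3 (base extension)] -/
def totalMEmb : (totalM k n d M).left ⟶ (incidenceOpenM k n d M : Scheme.{u}) :=
  (isPullback_incidenceOpenM k n d M).lift
    (pullback.fst (family k n d).left (toBase k n d M).left ≫
      ((totalToSpec k n d) ⁻¹ᵁ (baseOpens k n d)).ι ≫ totalι k n d)
    (pullback.snd (family k n d).left (toBase k n d M).left)
    (by
      have w := (isPullback_totalM_totalToSpec k n d M).w
      simp only [Category.assoc] at w ⊢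
      exact w)

/-- `totalMEmb` followed by `Z → ℙⁿ⁺¹_{R_M} → ℙⁿ⁺¹_R` is `𝒴_M → 𝒴 ↪ ℙⁿ⁺¹_R`. [cite: Hartshorne1977, II §3 (base extension)] -/
@[reassoc]
theorem totalMEmb_comp_ι_projMapM :
    totalMEmb k n d M ≫ (incidenceOpenM k n d M).ι ≫ projMapM k n d M =
      pullback.fst (family k n d).left (toBase k n d M).left ≫
        ((totalToSpec k n d) ⁻¹ᵁ (baseOpens k n d)).ι ≫ totalι k n d :=
  IsPullback.lift_fst _ _ _ _

/-- `totalMEmb` followed by `Z → S_M` is `π_M` (as `pullback.snd`). [cite: Hartshorne1977, II §3 (base extension)] -/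
@[reassoc]
theorem totalMEmb_comp_restrict :
    totalMEmb k n d M ≫ (projSpToSpec n (CoeffRingM k n d M) ∣_ baseMOpens k n d M) =
      pullback.snd (family k n d).left (toBase k n d M).left :=
  IsPullback.lift_snd _ _ _ _

/-- **`𝒴_M ↪ Z` is the base change of `𝒴 ↪ ℙⁿ⁺¹_R`** along `Z → ℙⁿ⁺¹_R`. [cite: Hartshorne1977, II §3 (base extension)] -/
theorem isPullback_totalMEmb :
    IsPullback
      (pullback.fst (family k n d).left (toBase k n d M).left ≫
        ((totalToSpec k n d) ⁻¹ᵁ (baseOpens k n d)).ι)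
      (totalMEmb k n d M) (totalι k n d) ((incidenceOpenM k n d M).ι ≫ projMapM k n d M) := by
  refine IsPullback.of_bot ?_
    ((Category.assoc _ _ _).trans (totalMEmb_comp_ι_projMapM k n d M).symm)
    (isPullback_incidenceOpenM k n d M)
  have h := isPullback_totalM_totalToSpec k n d M
  rw [← totalMEmb_comp_restrict k n d M] at h
  exact h

/-- `𝒴_M ⟶ Z` is a closed immersion (base change of `𝒴 ↪ ℙⁿ⁺¹_R`). [cite: Hartshorne1977, II Ex. 3.11(a)] -/
instance isClosedImmersion_totalMEmb : IsClosedImmersion (totalMEmb k n d M) :=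
  MorphismProperty.of_isPullback (P := @IsClosedImmersion) (isPullback_totalMEmb k n d M)
    inferInstance

/-- **`𝒴_M ⊆ Z` has support `V₊(F_M) ∩ Z`**: the image of `𝒴_M ⟶ Z` is the preimage of
`V₊(F) ⊆ ℙⁿ⁺¹_R`, and `killHom F = F_M`. [cite: VoisinHodgeII2003, §6.2.1] -/
theorem range_totalMEmb :
    Set.range (totalMEmb k n d M) =
      {z | z.1 ∈ ProjectiveSpectrum.zeroLocus (𝒜 (CoeffRingM k n d M)) {universalFormM k n d M}} := by
  have h := isPullback_totalMEmb k n d M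
  have hsurj : Function.Surjective h.isoPullback.hom := h.isoPullback.hom.homeomorph.surjective
  have hr : Set.range (totalMEmb k n d M) =
      Set.range (pullback.snd (totalι k n d) ((incidenceOpenM k n d M).ι ≫ projMapM k n d M)) := by
    rw [← h.isoPullback_hom_snd]
    ext y
    simp only [Set.mem_range]
    constructor
    · rintro ⟨x, rfl⟩
      exact ⟨_, rfl⟩
    · rintro ⟨x, rfl⟩
      obtain ⟨x', rfl⟩ := hsurj x
      exact ⟨x', rfl⟩
  rw [hr, Scheme.Pullback.range_snd, range_totalι]
  ext z
  change ({universalForm k n d} : Set _) ⊆ _ ↔ ({universalFormM k n d M} : Set _) ⊆ _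
  rw [Set.singleton_subset_iff, Set.singleton_subset_iff, SetLike.mem_coe, SetLike.mem_coe,
    ← map_killHom_universalForm]
  exact mem_projMapM_apply_iff k n d M _ _

/-- `𝒴_M` is reduced for `d ≥ 1` (smooth over the field `k`: `π_M` is smooth of relative dimension
`n` and `S_M` is smooth; Stacks 056T). [cite: StacksProject, Tag 056T] -/
theorem isReduced_totalM_left (hd : 0 < d) : IsReduced (totalM k n d M).left := by
  haveI := smoothOfRelativeDimension_isStableUnderBaseChange (n := n)
  haveI : SmoothOfRelativeDimension n (familyM k n d M).left :=
    MorphismProperty.pullback_snd (P := @SmoothOfRelativeDimension n) _ _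
      (smoothOfRelativeDimension_family_left k n d hd)
  haveI := smoothOfRelativeDimension_baseM_hom k n d M
  haveI : SmoothOfRelativeDimension (n + (0 + Nat.card M)) (totalM k n d M).hom := by
    rw [← Over.w (familyM k n d M)]
    infer_instance
  exact @isReduced_of_smoothOfRelativeDimension k _ _ (totalM k n d M).hom (n + (0 + Nat.card M))
    inferInstance

/-! ### The closed immersion `W_M|_Z ↪ Z` and the comparison -/

/-- **The restriction `W_M|_Z ⟶ Z`** of `W_M ↪ ℙⁿ⁺¹_{R_M}` over the open part `Z` (Mathlib
`morphismRestrict`). [cite: Hartshorne1977, II Ex. 3.11(a)] -/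
abbrev incidenceRestrictM :
    (incidenceιM k n d M ⁻¹ᵁ incidenceOpenM k n d M).toScheme ⟶ (incidenceOpenM k n d M : Scheme.{u}) :=
  incidenceιM k n d M ∣_ incidenceOpenM k n d M

/-- `W_M|_Z ⟶ Z` is a closed immersion. [cite: Hartshorne1977, II Ex. 3.11(a)] -/
instance isClosedImmersion_incidenceRestrictM : IsClosedImmersion (incidenceRestrictM k n d M) :=
  IsZariskiLocalAtTarget.restrict (P := @IsClosedImmersion) inferInstance _

/-- Its image is `V₊(F_M) ∩ Z`. [cite: VoisinHodgeII2003, §6.2.1] -/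
theorem range_incidenceRestrictM :
    Set.range (incidenceRestrictM k n d M) =
      {z | z.1 ∈ ProjectiveSpectrum.zeroLocus (𝒜 (CoeffRingM k n d M)) {universalFormM k n d M}} := by
  ext z
  rw [← range_incidenceιM]
  constructor
  · rintro ⟨y, rfl⟩
    exact ⟨y.1, (morphismRestrict_base_coe (incidenceιM k n d M) (incidenceOpenM k n d M) y).symm⟩
  · rintro ⟨y, hy⟩
    have hy' : y ∈ incidenceιM k n d M ⁻¹ᵁ incidenceOpenM k n d M := by
      change incidenceιM k n d M y ∈ incidenceOpenM k n d M
      rw [hy]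
      exact z.2
    exact ⟨⟨y, hy'⟩, Subtype.ext (by rw [morphismRestrict_base_coe]; exact hy)⟩

/-- **`W_M` is reduced** (the reduced induced structure: its affine pieces are spectra of quotients by
radical ideals). [cite: Hartshorne1977, II Example 3.2.6] -/
theorem isReduced_incidenceM : IsReduced (incidenceM k n d M) := by
  change IsReduced (idealSheafM k n d M).subscheme
  haveI : ∀ U, IsReduced ((idealSheafM k n d M).subschemeCover.openCover.X U) := by
    intro (U : (projSp n (CoeffRingM k n d M)).affineOpens)
    change IsReduced (Spec (.of (Γ(projSp n (CoeffRingM k n d M),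
      (U : (projSp n (CoeffRingM k n d M)).Opens)) ⧸ (idealSheafM k n d M).ideal U)))
    haveI : _root_.IsReduced (Γ(projSp n (CoeffRingM k n d M),
        (U : (projSp n (CoeffRingM k n d M)).Opens)) ⧸ (idealSheafM k n d M).ideal U) := by
      rw [← Ideal.isRadical_iff_quotient_reduced, idealSheafM,
        Scheme.IdealSheafData.vanishingIdeal_ideal]
      exact PrimeSpectrum.isRadical_vanishingIdeal _
    infer_instance
  exact IsReduced.of_openCover _ (idealSheafM k n d M).subschemeCover.openCover

/-- `W_M|_Z` is reduced (open in the reduced `W_M`). [cite: Hartshorne1977, II Example 3.2.6] -/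
instance isReduced_incidenceRestrict :
    IsReduced (incidenceιM k n d M ⁻¹ᵁ incidenceOpenM k n d M).toScheme :=
  haveI := isReduced_incidenceM k n d M
  inferInstance

/-- **`𝒴_M ≅ W_M|_{S_M}` over `Z`** (`d ≥ 1`): both are reduced closed subschemes of `Z` with support
`V₊(F_M) ∩ Z` (uniqueness of the reduced induced structure, Hartshorne II Example 3.2.6,
`exists_iso_of_isClosedImmersion_of_range_eq`). [cite: Hartshorne1977, II Example 3.2.6] -/
theorem exists_totalMIsoIncidenceRestrict (hd : 0 < d) :
    ∃ e : (totalM k n d M).left ≅ (incidenceιM k n d M ⁻¹ᵁ incidenceOpenM k n d M).toScheme,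
      e.hom ≫ incidenceRestrictM k n d M = totalMEmb k n d M :=
  haveI := isReduced_totalM_left k n d M hd
  exists_iso_of_isClosedImmersion_of_range_eq (incidenceRestrictM k n d M) (totalMEmb k n d M)
    ((range_incidenceRestrictM k n d M).trans (range_totalMEmb k n d M).symm)

/-- The isomorphism `𝒴_M ≅ W_M|_{S_M}` (a choice). [cite: Hartshorne1977, II Example 3.2.6] -/
def totalMIsoIncidenceRestrict (hd : 0 < d) :
    (totalM k n d M).left ≅ (incidenceιM k n d M ⁻¹ᵁ incidenceOpenM k n d M).toScheme :=
  (exists_totalMIsoIncidenceRestrict k n d M hd).choose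

/-- Its defining property: composed with `W_M|_Z ↪ Z` it is `𝒴_M ↪ Z`. [cite: Hartshorne1977, II Example 3.2.6] -/
@[reassoc]
theorem totalMIsoIncidenceRestrict_hom_comp (hd : 0 < d) :
    (totalMIsoIncidenceRestrict k n d M hd).hom ≫ incidenceRestrictM k n d M = totalMEmb k n d M :=
  (exists_totalMIsoIncidenceRestrict k n d M hd).choose_spec

/-! ### The open immersion `𝒴_M ↪ W_M` of `k`-schemes -/

/-- The underlying morphism `𝒴_M ⟶ W_M`: `𝒴_M ≅ W_M|_{S_M} ⊆ W_M`. [cite: VoisinHodgeII2003, §6.2.1] -/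
def totalMToIncidenceHom (hd : 0 < d) : (totalM k n d M).left ⟶ incidenceM k n d M :=
  (totalMIsoIncidenceRestrict k n d M hd).hom ≫ (incidenceιM k n d M ⁻¹ᵁ incidenceOpenM k n d M).ι

/-- `𝒴_M ⟶ W_M ↪ ℙⁿ⁺¹_{R_M}` is `𝒴_M ↪ Z ⊆ ℙⁿ⁺¹_{R_M}`. [cite: VoisinHodgeII2003, §6.2.1] -/
@[reassoc]
theorem totalMToIncidenceHom_comp_incidenceιM (hd : 0 < d) :
    totalMToIncidenceHom k n d M hd ≫ incidenceιM k n d M =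
      totalMEmb k n d M ≫ (incidenceOpenM k n d M).ι := by
  rw [totalMToIncidenceHom, Category.assoc, ← morphismRestrict_ι,
    totalMIsoIncidenceRestrict_hom_comp_assoc]

/-- `𝒴_M ⟶ W_M → 𝔸^M` is `𝒴_M → S_M ⊆ 𝔸^M`. [cite: VoisinHodgeII2003, §6.2.1] -/
@[reassoc]
theorem totalMToIncidenceHom_comp_incidenceToSpecM (hd : 0 < d) :
    totalMToIncidenceHom k n d M hd ≫ incidenceToSpecM k n d M =
      (familyM k n d M).left ≫ (baseMOpens k n d M).ι := by
  change totalMToIncidenceHom k n d M hd ≫ incidenceιM k n d M ≫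
      projSpToSpec n (CoeffRingM k n d M) = pullback.snd _ _ ≫ _
  rw [totalMToIncidenceHom_comp_incidenceιM_assoc, ← morphismRestrict_ι,
    totalMEmb_comp_restrict_assoc]
  rfl

/-- **The open immersion `𝒴_M ⟶ W_M` of `k`-schemes** (`d ≥ 1`): the family of smooth `M`-supported
hypersurfaces is the part of the incidence variety `W_M = {(f, x) | f(x) = 0}` over the nonsingular
forms `S_M ⊆ 𝔸^M`. [cite: VoisinHodgeII2003, §6.2.1] -/
def totalMToIncidence (hd : 0 < d) : totalM k n d M ⟶ incidenceOverM k n d M :=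
  Over.homMk (totalMToIncidenceHom k n d M hd) (by
    change totalMToIncidenceHom k n d M hd ≫ incidenceToSpecM k n d M ≫ specMToSpec k n d M =
      (totalM k n d M).hom
    exact ((Category.assoc _ _ _).symm.trans (congrArg (· ≫ specMToSpec k n d M)
      (totalMToIncidenceHom_comp_incidenceToSpecM k n d M hd))).trans
      ((Category.assoc _ _ _).trans (Over.w (familyM k n d M))))

/-- Its underlying morphism (`rfl`). [cite: VoisinHodgeII2003, §6.2.1] -/
theorem totalMToIncidence_left (hd : 0 < d) :
    (totalMToIncidence k n d M hd).left = totalMToIncidenceHom k n d M hd := rfl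

/-- **`𝒴_M ⟶ W_M` is an open immersion** (an isomorphism onto the open subscheme `W_M|_{S_M}`).
[cite: VoisinHodgeII2003, §6.2.1] -/
instance isOpenImmersion_totalMToIncidence_left (hd : 0 < d) :
    IsOpenImmersion (totalMToIncidence k n d M hd).left := by
  have h : IsOpenImmersion ((totalMIsoIncidenceRestrict k n d M hd).hom ≫
      (incidenceιM k n d M ⁻¹ᵁ incidenceOpenM k n d M).ι) := inferInstance
  exact h

/-- `(𝒴_M ⟶ W_M) ≫ (W_M ↪ ℙⁿ⁺¹_{R_M}) = (𝒴_M ↪ Z) ≫ (Z ⊆ ℙⁿ⁺¹_{R_M})`. [cite: VoisinHodgeII2003, §6.2.1] -/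
@[reassoc]
theorem totalMToIncidence_left_comp_incidenceιM (hd : 0 < d) :
    (totalMToIncidence k n d M hd).left ≫ incidenceιM k n d M =
      totalMEmb k n d M ≫ (incidenceOpenM k n d M).ι :=
  totalMToIncidenceHom_comp_incidenceιM k n d M hd

end Squares

end Literature.AlgebraicGeometry.Motives.UniversalHypersurface

end
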